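import Summits.QuantumFields.YangMills.Theorems.LuscherReductionRunningReductionInnerCopies
import Summits.QuantumFields.YangMills.Theorems.LuscherReductionTwistedTraceScalingElectricSplit
import HarnessLib

/-!
# The transfer form of a twist symmetrisation: eight equal diagonal terms + exponentially small cross terms (sub-stub C2f of the
# fixed-lattice programme COARSE(L₀) — route `LuscherReduction`, crux RED stmt-QuantumFields-19978 KT-door 3b′ / crux `TwistedTraceScaling`
# stmt-QuantumFields-20203 S-BASE; design note `pub/ym-fleet/ym-luscher-20007-p1/COARSE-DESIGN.md` §2, §7 brick (i))

Companion of `…InnerCopies` (`twistSum`, `l2_twistSum`).  For `φ` bounded, measurable and supported in `{orbitDist < δ}`: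
* `sum_frobNorm_ge_of_twist_ne` — two DIFFERENT twisted copies are separated in link distance: `orbitDist(τ_z U) < δ`, `orbitDist(τ_{z'} V) < δ`,
  `z ≠ z'`, `L(δ+m) < 2` ⇒ `Σ_e ‖U_e − V_e‖_F ≥ m` (1-Lipschitz orbit distances + `twist3_eq_of_orbitDist_lt`);
* `transferKernel_le_crossBound` — across that distance the kernel is `≤ crossBound L β m = e^{2β|E|}·e^{−(β/2)m²/|E|}` (exact Gaussian form of the
  electric factor, `latE_eq_exp_frobSq`, and Cauchy–Schwarz over the links);
* ★ `abs_qform_twistSum_sub_le` — `|⟨twistSum φ, K_β twistSum φ⟩ − 8⟨φ, K_β φ⟩| ≤ 56 · crossBound L β m · ‖φ‖²`: the `8` diagonal terms are all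
  `⟨φ,K_βφ⟩` (twist invariance of kernel and measure), the `56` cross terms are bounded by Schur–Young `|a K b| ≤ K_max (a² + b²)/2`.
With `…InnerCopies`: for a physical `ψ` and `L·δ < 1` (say), the INNER piece `ψ_in = cos Θ_δ ψ = twistSum(innerCut δ·ψ)` has
`‖ψ_in‖² = 8‖χψ‖²` and `⟨ψ_in,Kψ_in⟩ = 8⟨χψ,Kχψ⟩ + O(e^{2β|E|}e^{−βm²/(2|E|)})‖χψ‖²`, `χ = innerCut δ`: the Born–Oppenheimer analysis (C4) may be
done for ONE gauge-invariant function localized at the trivial orbit.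
HONEST FRAMING: region bookkeeping on a fixed lattice; femto rung R2b1; not a gap, not infinite volume, not Clay.
-/

set_option autoImplicit false

noncomputable section

open MeasureTheory Filter Topology Real
open scoped Matrix ComplexConjugate BigOperators
open Literature.MathematicalPhysics.QuantumFieldTheory
open Literature.MathematicalPhysics.QuantumLattice

namespace Summit.QuantumFields.YangMills.Theorems.FemtoTransferGap

variable {L : ℕ} [NeZero L]

/-! ## §1 Different copies are separated in link distance -/

/-- ★ **Separation of two different twisted copies**: if `orbitDist(τ_z U) < δ`, `orbitDist(τ_{z'} V) < δ`, `z ≠ z'` and `L(δ + m) < 2`, then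
`Σ_e ‖U_e − V_e‖_F ≥ m`. [folklore] -/
theorem sum_frobNorm_ge_of_twist_ne {δ m : ℝ} (hL : (L : ℝ) * (δ + m) < 2) {z z' : Fin 3 → Bool} (hne : z ≠ z')
    {U V : GaugeConfig 3 L SU2} (hU : orbitDist (TT.twist3 z U) < δ) (hV : orbitDist (TT.twist3 z' V) < δ) :
    m ≤ ∑ e : Edge 3 L, frobNorm (((U e : SU2) : Matrix (Fin 2) (Fin 2) ℂ) - ((V e : SU2) : Matrix (Fin 2) (Fin 2) ℂ)) := by
  by_contra hlt
  rw [not_le] at hlt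
  have hD0 : 0 ≤ ∑ e : Edge 3 L, frobNorm (((U e : SU2) : Matrix (Fin 2) (Fin 2) ℂ) - ((V e : SU2) : Matrix (Fin 2) (Fin 2) ℂ)) :=
    Finset.sum_nonneg fun e _ => frobNorm_nonneg _
  have h := abs_orbitDist_twist3_sub_le z U V
  rw [abs_le] at h
  have h1 : orbitDist (TT.twist3 z V) < δ + m := by linarith [h.1]
  have h2 : orbitDist (TT.twist3 z' V) < δ + m := by linarith
  exact hne (twist3_eq_of_orbitDist_lt hL h1 h2)

/-! ## §2 The kernel across copies -/

variable (L) in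
/-- **Cross-copy kernel bound** `crossBound L β m = e^{2β|E|} · e^{−(β/2)·m²/|E|}`. [folklore] -/
def crossBound (β m : ℝ) : ℝ :=
  Real.exp (2 * β) ^ Fintype.card (Edge 3 L) * Real.exp (-(β / 2 * (m ^ 2 / Fintype.card (Edge 3 L))))

/-- `0 < crossBound`. [folklore] -/
theorem crossBound_pos (β m : ℝ) : 0 < crossBound L β m := mul_pos (pow_pos (Real.exp_pos _) _) (Real.exp_pos _)

/-- ★ **`K_β(U,V) ≤ crossBound L β m`** when `Σ_e ‖U_e − V_e‖_F ≥ m ≥ 0` (`β ≥ 0`): `K ≤ E_β = e^{2β|E|}e^{−(β/2)Σ_e‖U_e−V_e‖²}` and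
`Σ_e‖U_e−V_e‖² ≥ (Σ_e‖U_e−V_e‖)²/|E|`. [cite: MontvayMunster1994, §3.2.3 (3.97)] -/
theorem transferKernel_le_crossBound {β : ℝ} (hβ : 0 ≤ β) {m : ℝ} (hm : 0 ≤ m) {U V : GaugeConfig 3 L SU2}
    (hUV : m ≤ ∑ e : Edge 3 L, frobNorm (((U e : SU2) : Matrix (Fin 2) (Fin 2) ℂ) - ((V e : SU2) : Matrix (Fin 2) (Fin 2) ℂ))) :
    transferKernel su2Rep β U V ≤ crossBound L β m := by
  refine (transferKernel_le_latE hβ U V).trans ?_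
  rw [TwoLattice.Electric.latE_eq_exp_frobSq]
  unfold crossBound
  refine mul_le_mul_of_nonneg_left (Real.exp_le_exp.mpr ?_) (pow_nonneg (Real.exp_pos _).le _)
  have hE : (0 : ℝ) < Fintype.card (Edge 3 L) := by exact_mod_cast Fintype.card_pos
  have h1 : m ^ 2 ≤ (∑ e : Edge 3 L, frobNorm (((U e : SU2) : Matrix (Fin 2) (Fin 2) ℂ) - ((V e : SU2) : Matrix (Fin 2) (Fin 2) ℂ))) ^ 2 :=
    pow_le_pow_left₀ hm hUV 2
  have h2 := sq_sum_edge_le_lat (fun e : Edge 3 L => frobNorm (((U e : SU2) : Matrix (Fin 2) (Fin 2) ℂ) - ((V e : SU2) : Matrix (Fin 2) (Fin 2) ℂ)))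
  have h3 : m ^ 2 / Fintype.card (Edge 3 L) ≤
      ∑ e : Edge 3 L, frobNorm (((U e : SU2) : Matrix (Fin 2) (Fin 2) ℂ) - ((V e : SU2) : Matrix (Fin 2) (Fin 2) ℂ)) ^ 2 := by
    rw [div_le_iff₀ hE]; nlinarith
  have h4 := mul_le_mul_of_nonneg_left h3 (by linarith : 0 ≤ β / 2)
  linarith

/-- **Schur–Young bound for one cross term, pointwise**: for `z ≠ z'`, `φ` supported in `{orbitDist < δ}`, `L(δ+m) < 2`, `m ≥ 0`, `β ≥ 0`:
`|φ(τ_z U) K(U,V) φ(τ_{z'} V)| ≤ crossBound · (φ(τ_z U)² + φ(τ_{z'} V)²)/2`. [folklore] -/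
theorem abs_cross_integrand_le {β : ℝ} (hβ : 0 ≤ β) {φ : GaugeConfig 3 L SU2 → ℝ} {δ m : ℝ} (hm : 0 ≤ m) (hL : (L : ℝ) * (δ + m) < 2)
    (hφ : ∀ U, φ U ≠ 0 → orbitDist U < δ) {z z' : Fin 3 → Bool} (hne : z ≠ z') (p : GaugeConfig 3 L SU2 × GaugeConfig 3 L SU2) :
    |φ (TT.twist3 z p.1) * transferKernel su2Rep β p.1 p.2 * φ (TT.twist3 z' p.2)| ≤
      crossBound L β m * ((φ (TT.twist3 z p.1) ^ 2 + φ (TT.twist3 z' p.2) ^ 2) / 2) := by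
  have hR : 0 ≤ crossBound L β m * ((φ (TT.twist3 z p.1) ^ 2 + φ (TT.twist3 z' p.2) ^ 2) / 2) :=
    mul_nonneg (crossBound_pos β m).le (by positivity)
  by_cases ha : φ (TT.twist3 z p.1) = 0
  · have h0 : |φ (TT.twist3 z p.1) * transferKernel su2Rep β p.1 p.2 * φ (TT.twist3 z' p.2)| = 0 := by rw [ha, zero_mul, zero_mul, abs_zero]
    rw [h0]; exact hR
  by_cases hb : φ (TT.twist3 z' p.2) = 0
  · have h0 : |φ (TT.twist3 z p.1) * transferKernel su2Rep β p.1 p.2 * φ (TT.twist3 z' p.2)| = 0 := by rw [hb, mul_zero, abs_zero]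
    rw [h0]; exact hR
  have hK : transferKernel su2Rep β p.1 p.2 ≤ crossBound L β m :=
    transferKernel_le_crossBound hβ hm (sum_frobNorm_ge_of_twist_ne hL hne (hφ _ ha) (hφ _ hb))
  rw [abs_mul, abs_mul, abs_of_pos (transferKernel_pos _ _ _ _)]
  have h2 : 2 * (|φ (TT.twist3 z p.1)| * |φ (TT.twist3 z' p.2)|) ≤ φ (TT.twist3 z p.1) ^ 2 + φ (TT.twist3 z' p.2) ^ 2 := by
    have h := two_mul_le_add_sq |φ (TT.twist3 z p.1)| |φ (TT.twist3 z' p.2)|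
    rw [sq_abs, sq_abs] at h; linarith
  calc |φ (TT.twist3 z p.1)| * transferKernel su2Rep β p.1 p.2 * |φ (TT.twist3 z' p.2)|
      = transferKernel su2Rep β p.1 p.2 * (|φ (TT.twist3 z p.1)| * |φ (TT.twist3 z' p.2)|) := by ring
    _ ≤ crossBound L β m * (|φ (TT.twist3 z p.1)| * |φ (TT.twist3 z' p.2)|) := mul_le_mul_of_nonneg_right hK (by positivity)
    _ ≤ crossBound L β m * ((φ (TT.twist3 z p.1) ^ 2 + φ (TT.twist3 z' p.2) ^ 2) / 2) :=
        mul_le_mul_of_nonneg_left (by linarith) (crossBound_pos β m).le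

/-! ## §3 The transfer form of a twist symmetrisation, term by term -/

/-- `⟨twistSum φ, K_β twistSum φ⟩ = Σ_z Σ_{z'} ∫∫ φ(τ_z U) K_β(U,V) φ(τ_{z'} V)` (bounded measurable `φ`, `β ≥ 0`). [folklore] -/
theorem qform_twistSum_eq_sum {β : ℝ} (hβ : 0 ≤ β) {φ : GaugeConfig 3 L SU2 → ℝ} (hmφ : Measurable φ) {C : ℝ} (hC : ∀ U, |φ U| ≤ C) :
    qform su2Rep β (twistSum φ) (twistSum φ) = ∑ z : Fin 3 → Bool, ∑ z' : Fin 3 → Bool,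
      ∫ p, φ (TT.twist3 z p.1) * transferKernel su2Rep β p.1 p.2 * φ (TT.twist3 z' p.2) ∂(configMeasure SU2 L).prod (configMeasure SU2 L) := by
  have hint := integrable_latSandwich (measurable_transferKernel_lat β) (abs_transferKernel_le_lat hβ) (measurable_twistSum hmφ)
    (measurable_twistSum hmφ) (abs_twistSum_le hC) (abs_twistSum_le hC)
  have hprod : qform su2Rep β (twistSum φ) (twistSum φ) =
      ∫ p, twistSum φ p.1 * transferKernel su2Rep β p.1 p.2 * twistSum φ p.2 ∂(configMeasure SU2 L).prod (configMeasure SU2 L) :=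
    (integral_prod _ hint).symm
  have hterm : ∀ z z' : Fin 3 → Bool, Integrable (fun p : GaugeConfig 3 L SU2 × GaugeConfig 3 L SU2 =>
      φ (TT.twist3 z p.1) * transferKernel su2Rep β p.1 p.2 * φ (TT.twist3 z' p.2)) ((configMeasure SU2 L).prod (configMeasure SU2 L)) :=
    fun z z' => integrable_latSandwich (measurable_transferKernel_lat β) (abs_transferKernel_le_lat hβ) (hmφ.comp (TT.measurable_twist3 z))
      (hmφ.comp (TT.measurable_twist3 z')) (fun U => hC _) (fun V => hC _)
  have hpt : ∀ p : GaugeConfig 3 L SU2 × GaugeConfig 3 L SU2, twistSum φ p.1 * transferKernel su2Rep β p.1 p.2 * twistSum φ p.2 =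
      ∑ z : Fin 3 → Bool, ∑ z' : Fin 3 → Bool, φ (TT.twist3 z p.1) * transferKernel su2Rep β p.1 p.2 * φ (TT.twist3 z' p.2) := fun p => by
    unfold twistSum
    rw [Finset.sum_mul, Finset.sum_mul_sum]
  rw [hprod]
  simp_rw [hpt]
  rw [integral_finsetSum _ fun z _ => integrable_finsetSum _ fun z' _ => hterm z z']
  exact Finset.sum_congr rfl fun z _ => integral_finsetSum _ fun z' _ => hterm z z'

/-- **Diagonal terms**: `∫∫ φ(τ_z U) K_β(U,V) φ(τ_z V) = ⟨φ, K_β φ⟩` (twist invariance of the kernel and of the a-priori measure).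
[cite: tHooft1979] -/
theorem cross_diag_eq_qform {β : ℝ} (hβ : 0 ≤ β) {φ : GaugeConfig 3 L SU2 → ℝ} (hmφ : Measurable φ) {C : ℝ} (hC : ∀ U, |φ U| ≤ C)
    (z : Fin 3 → Bool) :
    ∫ p, φ (TT.twist3 z p.1) * transferKernel su2Rep β p.1 p.2 * φ (TT.twist3 z p.2) ∂(configMeasure SU2 L).prod (configMeasure SU2 L) =
      qform su2Rep β φ φ := by
  have hT : MeasurePreserving (Prod.map (TT.twist3 z) (TT.twist3 z)) ((configMeasure SU2 L).prod (configMeasure SU2 L))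
      ((configMeasure SU2 L).prod (configMeasure SU2 L)) := (TT.measurePreserving_twist3 z).prod (TT.measurePreserving_twist3 z)
  have hG : Measurable fun q : GaugeConfig 3 L SU2 × GaugeConfig 3 L SU2 => φ q.1 * transferKernel su2Rep β q.1 q.2 * φ q.2 :=
    ((hmφ.comp measurable_fst).mul (measurable_transferKernel_lat β)).mul (hmφ.comp measurable_snd)
  have h1 : (fun p : GaugeConfig 3 L SU2 × GaugeConfig 3 L SU2 => φ (TT.twist3 z p.1) * transferKernel su2Rep β p.1 p.2 * φ (TT.twist3 z p.2)) =
      fun p => (fun q : GaugeConfig 3 L SU2 × GaugeConfig 3 L SU2 => φ q.1 * transferKernel su2Rep β q.1 q.2 * φ q.2)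
        (Prod.map (TT.twist3 z) (TT.twist3 z) p) := by
    funext p
    simp only [Prod.map_fst, Prod.map_snd, TT.transferKernel_twist3]
  rw [h1]
  have h2 := integral_map (μ := (configMeasure SU2 L).prod (configMeasure SU2 L)) hT.measurable.aemeasurable
    (f := fun q : GaugeConfig 3 L SU2 × GaugeConfig 3 L SU2 => φ q.1 * transferKernel su2Rep β q.1 q.2 * φ q.2) hG.aestronglyMeasurable
  rw [hT.map_eq] at h2
  rw [← h2]
  exact integral_prod _ (integrable_latSandwich (measurable_transferKernel_lat β) (abs_transferKernel_le_lat hβ) hmφ hmφ hC hC)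

/-- `∫ φ(τ_z U)² dU = ‖φ‖²`. [folklore] -/
theorem integral_sq_twist3 {φ : GaugeConfig 3 L SU2 → ℝ} (hmφ : Measurable φ) (z : Fin 3 → Bool) :
    ∫ U, φ (TT.twist3 z U) ^ 2 ∂configMeasure SU2 L = l2 φ φ := by
  unfold l2
  simp_rw [← sq]
  exact integral_comp_eq_of_measurePreserving (TT.measurePreserving_twist3 z) (F := fun U => φ U ^ 2) (hmφ.pow_const 2)

/-- **Cross terms**: for `z ≠ z'`, `|∫∫ φ(τ_z U) K_β φ(τ_{z'} V)| ≤ crossBound L β m · ‖φ‖²` (`φ` bounded measurable, supported in `{orbitDist < δ}`,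
`L(δ+m) < 2`, `m ≥ 0`, `β ≥ 0`). [folklore] -/
theorem abs_cross_offdiag_le {β : ℝ} (hβ : 0 ≤ β) {φ : GaugeConfig 3 L SU2 → ℝ} (hmφ : Measurable φ) {C : ℝ} (hC : ∀ U, |φ U| ≤ C)
    {δ m : ℝ} (hm : 0 ≤ m) (hL : (L : ℝ) * (δ + m) < 2) (hφ : ∀ U, φ U ≠ 0 → orbitDist U < δ) {z z' : Fin 3 → Bool} (hne : z ≠ z') :
    |∫ p, φ (TT.twist3 z p.1) * transferKernel su2Rep β p.1 p.2 * φ (TT.twist3 z' p.2) ∂(configMeasure SU2 L).prod (configMeasure SU2 L)| ≤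
      crossBound L β m * l2 φ φ := by
  have hC0 : 0 ≤ C := (abs_nonneg _).trans (hC 1)
  have hsqb : ∀ (w : Fin 3 → Bool) (U : GaugeConfig 3 L SU2), |φ (TT.twist3 w U) ^ 2| ≤ C ^ 2 := fun w U => by
    rw [abs_pow]; exact pow_le_pow_left₀ (abs_nonneg _) (hC _) 2
  have hint : Integrable (fun p : GaugeConfig 3 L SU2 × GaugeConfig 3 L SU2 =>
      crossBound L β m * ((φ (TT.twist3 z p.1) ^ 2 + φ (TT.twist3 z' p.2) ^ 2) / 2)) ((configMeasure SU2 L).prod (configMeasure SU2 L)) := by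
    refine integrable_latProd ?_ (C := crossBound L β m * ((C ^ 2 + C ^ 2) / 2)) fun p => ?_
    · exact ((((hmφ.comp (TT.measurable_twist3 z)).pow_const 2).comp measurable_fst |>.add
        (((hmφ.comp (TT.measurable_twist3 z')).pow_const 2).comp measurable_snd)).div_const 2).const_mul _
    · rw [abs_mul, abs_of_pos (crossBound_pos β m), abs_div, abs_two]
      refine mul_le_mul_of_nonneg_left (div_le_div_of_nonneg_right ((abs_add_le _ _).trans (add_le_add (hsqb z p.1) (hsqb z' p.2))) zero_le_two)
        (crossBound_pos β m).le
  calc |∫ p, φ (TT.twist3 z p.1) * transferKernel su2Rep β p.1 p.2 * φ (TT.twist3 z' p.2) ∂(configMeasure SU2 L).prod (configMeasure SU2 L)|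
      ≤ ∫ p, |φ (TT.twist3 z p.1) * transferKernel su2Rep β p.1 p.2 * φ (TT.twist3 z' p.2)| ∂(configMeasure SU2 L).prod (configMeasure SU2 L) :=
        abs_integral_le_integral_abs
    _ ≤ ∫ p, crossBound L β m * ((φ (TT.twist3 z p.1) ^ 2 + φ (TT.twist3 z' p.2) ^ 2) / 2) ∂(configMeasure SU2 L).prod (configMeasure SU2 L) :=
        integral_mono_of_nonneg (ae_of_all _ fun p => abs_nonneg _) hint (ae_of_all _ fun p => abs_cross_integrand_le hβ hm hL hφ hne p)
    _ = crossBound L β m * l2 φ φ := by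
        rw [integral_const_mul]
        congr 1
        have ha : Integrable (fun p : GaugeConfig 3 L SU2 × GaugeConfig 3 L SU2 => φ (TT.twist3 z p.1) ^ 2)
            ((configMeasure SU2 L).prod (configMeasure SU2 L)) :=
          integrable_latProd (((hmφ.comp (TT.measurable_twist3 z)).pow_const 2).comp measurable_fst) fun p => hsqb z p.1
        have hb : Integrable (fun p : GaugeConfig 3 L SU2 × GaugeConfig 3 L SU2 => φ (TT.twist3 z' p.2) ^ 2)
            ((configMeasure SU2 L).prod (configMeasure SU2 L)) :=
          integrable_latProd (((hmφ.comp (TT.measurable_twist3 z')).pow_const 2).comp measurable_snd) fun p => hsqb z' p.2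
        rw [integral_div, integral_add ha hb,
          integral_fun_fst (μ := configMeasure SU2 L) (ν := configMeasure SU2 L) (fun U : GaugeConfig 3 L SU2 => φ (TT.twist3 z U) ^ 2),
          integral_fun_snd (μ := configMeasure SU2 L) (ν := configMeasure SU2 L) (fun V : GaugeConfig 3 L SU2 => φ (TT.twist3 z' V) ^ 2),
          probReal_univ, one_smul, one_smul, integral_sq_twist3 hmφ, integral_sq_twist3 hmφ]
        ring

/-! ## §4 Eight diagonal terms and fifty-six cross terms -/

/-- Bookkeeping on `(ℤ/2)³ × (ℤ/2)³`: equal diagonal, bounded off-diagonal. [folklore] -/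
theorem abs_sum_sum_sub_le (T : (Fin 3 → Bool) → (Fin 3 → Bool) → ℝ) {q B : ℝ} (hd : ∀ z, T z z = q)
    (ho : ∀ z z', z ≠ z' → |T z z'| ≤ B) :
    |∑ z : Fin 3 → Bool, ∑ z' : Fin 3 → Bool, T z z' - 8 * q| ≤ 56 * B := by
  have hsplit : ∀ z : Fin 3 → Bool, ∑ z' : Fin 3 → Bool, T z z' = q + ∑ z' ∈ Finset.univ.erase z, T z z' := fun z => by
    rw [← Finset.add_sum_erase _ _ (Finset.mem_univ z), hd]
  simp_rw [hsplit]
  rw [Finset.sum_add_distrib, Finset.sum_const, Finset.card_univ, TT.card_twists, nsmul_eq_mul]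
  have hcard : ∀ z : Fin 3 → Bool, (Finset.univ.erase z).card = 7 := fun z => by
    rw [Finset.card_erase_of_mem (Finset.mem_univ z), Finset.card_univ, TT.card_twists]
  calc |((8 : ℕ) : ℝ) * q + ∑ z : Fin 3 → Bool, ∑ z' ∈ Finset.univ.erase z, T z z' - 8 * q|
      = |∑ z : Fin 3 → Bool, ∑ z' ∈ Finset.univ.erase z, T z z'| := by push_cast; ring_nf
    _ ≤ ∑ z : Fin 3 → Bool, |∑ z' ∈ Finset.univ.erase z, T z z'| := Finset.abs_sum_le_sum_abs _ _
    _ ≤ ∑ z : Fin 3 → Bool, ∑ z' ∈ Finset.univ.erase z, |T z z'| := Finset.sum_le_sum fun z _ => Finset.abs_sum_le_sum_abs _ _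
    _ ≤ ∑ z : Fin 3 → Bool, ∑ _z' ∈ Finset.univ.erase z, B :=
        Finset.sum_le_sum fun z _ => Finset.sum_le_sum fun z' hz' => ho z z' (Finset.ne_of_mem_erase hz').symm
    _ = 56 * B := by
        simp only [Finset.sum_const, hcard, Finset.card_univ, TT.card_twists, nsmul_eq_mul]
        push_cast; ring

/-- ★★ **The transfer form of a twist symmetrisation**: for `φ` bounded, measurable and supported in `{orbitDist < δ}`, `m ≥ 0` with
`L(δ + m) < 2`, and `β ≥ 0`,
`|⟨twistSum φ, K_β twistSum φ⟩ − 8⟨φ, K_β φ⟩| ≤ 56 · e^{2β|E|} e^{−(β/2)m²/|E|} · ‖φ‖²`. [folklore] -/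
theorem abs_qform_twistSum_sub_le {β : ℝ} (hβ : 0 ≤ β) {φ : GaugeConfig 3 L SU2 → ℝ} (hmφ : Measurable φ) {C : ℝ} (hC : ∀ U, |φ U| ≤ C)
    {δ m : ℝ} (hm : 0 ≤ m) (hL : (L : ℝ) * (δ + m) < 2) (hφ : ∀ U, φ U ≠ 0 → orbitDist U < δ) :
    |qform su2Rep β (twistSum φ) (twistSum φ) - 8 * qform su2Rep β φ φ| ≤ 56 * (crossBound L β m * l2 φ φ) := by
  rw [qform_twistSum_eq_sum hβ hmφ hC]
  exact abs_sum_sum_sub_le (fun z z' => ∫ p, φ (TT.twist3 z p.1) * transferKernel su2Rep β p.1 p.2 * φ (TT.twist3 z' p.2)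
    ∂(configMeasure SU2 L).prod (configMeasure SU2 L)) (fun z => cross_diag_eq_qform hβ hmφ hC z)
    (fun z z' hne => abs_cross_offdiag_le hβ hmφ hC hm hL hφ hne)

/-- ★★ **The INNER piece of a physical `ψ`, as eight copies** (`δ > 0`, `m ≥ 0`, `L(δ+m) < 2`, `β ≥ 0`; `χ = innerCut δ`):
`|⟨cosΘ_δ ψ, K_β cosΘ_δ ψ⟩ − 8⟨χψ, K_β χψ⟩| ≤ 56 · crossBound L β m · ‖χψ‖²` and `‖cosΘ_δ ψ‖² = 8‖χψ‖²` (`l2_inner_eq`). [folklore] -/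
theorem abs_qform_inner_sub_le {β : ℝ} (hβ : 0 ≤ β) {δ m : ℝ} (hδ : 0 < δ) (hm : 0 ≤ m) (hL : (L : ℝ) * (δ + m) < 2)
    {ψ : GaugeConfig 3 L SU2 → ℝ} (hψ : IsPhys ψ) :
    |qform su2Rep β (fun U => Real.cos (innerPhase δ U) * ψ U) (fun U => Real.cos (innerPhase δ U) * ψ U) -
        8 * qform su2Rep β (fun V => innerCut δ V * ψ V) (fun V => innerCut δ V * ψ V)| ≤
      56 * (crossBound L β m * l2 (fun V => innerCut δ V * ψ V) (fun V => innerCut δ V * ψ V)) := by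
  obtain ⟨C, hC⟩ := hψ.bounded
  have hLδ : (L : ℝ) * δ < 2 := by
    have hL0 : (0 : ℝ) ≤ L := Nat.cast_nonneg L
    nlinarith
  have hfun : (fun U => Real.cos (innerPhase δ U) * ψ U) = twistSum (fun V => innerCut δ V * ψ V) :=
    funext fun U => cos_innerPhase_mul_eq_twistSum hδ hLδ hψ U
  rw [hfun]
  exact abs_qform_twistSum_sub_le hβ (measurable_innerCut_mul δ hψ) (abs_innerCut_mul_le δ hC) hm hL
    (fun U h => orbitDist_lt_of_innerCut_mul_ne_zero hδ ψ h)

end Summit.QuantumFields.YangMills.Theorems.FemtoTransferGap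

end
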